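import Literature.MathematicalPhysics.QuantumLattice.InfVolFermionStateTorusLimitTwoSectorPairCompanionEnergyWindow
import Literature.MathematicalPhysics.QuantumLattice.HubbardTTPrimeThermalWindowCertificateSpinSector
import HarnessLib

/-!
# The «add↑» companion `(k_L + 1, k_L)` of the thermal object of record: reversed row, ratio convergence for a
# given pair, energy-window rows and the thermal reader

Topic `Literature/MathematicalPhysics/QuantumLattice`; the particle-ADDITION counterpart of
`InfVolFermionStateTorusLimitTwoSectorReverseRow.lean` §3 / `…CompanionEnergyWindow.lean` /
`HubbardTTPrimeThermalWindowCertificateSpinSector.lean` (which treat the «rm↑» companion `(k_L − 1, k_L)` and the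
pair companion). The «add↑» rows of the thermal object of record `ω` (torus limits of the canonical
`(rectN n L, S^z = 0)` Gibbs states) pair `ω` with a companion `ω'` on the image sectors `(k_L + 1, k_L)` of
`c†_{x↑}` and the limit `r = lim Z_{(k+1,k)}/Z_{(k,k)}` (`= e^{−βμ⁺_can}`, the canonical cost of ADDING an
up-electron; existence: `…exists_twoSector_succCompanion_of_sectorGibbs`). This file supplies, for this companion:

* §1 densities `Re ω'(n_{0↓}) = n/2` (`n_{0↑}`: `…re_expect_nAt_up_eq_half_of_succCompanion`), entropy
  `log #(k+1, k) ≤ s·L²` eventually for `s > 2H_b(n/2)`, positivity of the ratio, and the REVERSED row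
  (`…re_expect_twoSector_eeb_annihilation_up_reverse_nonneg_of_succCompanion`): the lowering generator `c_{x↑}`
  read from the companion, `(k + 1, k) → (k, k)`, with the inverted ratio;
* §2 for a GIVEN pair `(ω, ω')` along a common `Ls` (`0 < n < 2`) the ratio converges to some `r > 0` along a
  subsequence (`x`-moment of `c†_{0↑}` in `ω` is `1 − n/2`, `y'`-moment `Re ω'(c̃†c̃) = n/2`);
* §3 energy-window rows, hypothesis-free (`β > 0`): `e_Φ(ω') ≤ e_Φ(ω) + 2H_b(n/2)/β` and the reverse, the
  FLOOR `e(n) ≤ e_Φ(ω')` and the CAP `e_Φ(ω') ≤ e(n) + 2H_b(n/2)/β` (`U ≥ 0`) — the record N2′ window;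
* §4 the `D₄`-reduced thermal READER for `ω'` with densities evaluated
  (`…re_expect_ge_of_thermal_certificate_d4_TT'_of_succCompanion`).

Everything is PROVED; no definition, no named fact. HONEST SCOPE as in the companion files (pairs of states along
a common side sequence; no `ω' = ω`; no number).

## Mathlib / tree search

REUSED: `…exists_twoSector_companion_of_pos_moments`-style Bolzano–Weierstrass (`tendsto_subseq_of_bounded`);
`…re_expect_twoSector_eeb_creation_up_nonneg_of_sectorGibbs`, `creation_up_mulVec_mem_szSector_succ`,
`annihilation_up_mulVec_mem_szSector_rectN_of_succ`, `fermionEmbed_toTorusEmb_incl_annihilation/creation`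
(`…SingleCreator/Annihilator`); `InfVolFermionState.re_expect_twoSector_eeb_nonneg_of_canonical_limits_eventually`;
`…meanEnergy_le_meanEnergy_add_of_partitionRatio`, `…meanEnergy_companion_le_energyDensityTT'_add_of_partitionRatio`
(`TorusGibbsTwoSectorFreeEnergyComparison`, `…PairCompanionEnergyWindow`); `…re_expect_ge_of_thermal_certificate_d4_TT'_of_spinSectorGibbs`
(`…ThermalWindowCertificateSpinSector`); densities/bookkeeping of `…ReverseRow`, `…CompanionChain`.
`lean search 'succCompanion_le|reverse_nonneg_of_succ'`: nothing (2026-08-27).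

## References

* O. Bratteli, D. W. Robinson, *OAQSM 2* (1997), Thm. 5.3.15, §5.4.2. [cite: BratteliRobinsonII1997, §5.4.2]
* H. Fawzi, O. Fawzi, S. O. Scalet (2024), Thm. 3.1, Thm. 3.6. [cite: FawziFawziScalet2024, Thm. 3.1]
* R. B. Israel, *Convexity in the Theory of Lattice Gases* (1979), Lemma II.3.1. [cite: Israel1979, Lemma II.3.1]
* D. Ruelle, *Statistical Mechanics: Rigorous Results* (1969), §3.4. [cite: Ruelle1969, §3.4]
* E. H. Lieb, Phys. Rev. Lett. 62 (1989) 1201, proof of Thm. 1. [cite: LiebPRL1989, proof of Theorem 1]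
-/

noncomputable section

namespace Literature.MathematicalPhysics.QuantumLattice

open Matrix Finset HubbardWave0 Literature.Probability.LatticeModels ThermodynamicLimit
open Literature.MathematicalPhysics.QuantumManyBody.StateRelaxation
open _root_.Filter
open scoped _root_.Topology ComplexOrder BigOperators

/-! ### §1 Densities, entropy, positivity of the ratio, and the reversed row -/

section Basic

variable (t t' U β : ℝ)

namespace InfVolFermionState

/-- **Down-spin density of the «add↑» companion `(k_L + 1, k_L)`**: `Re ω'(n_{0↓}) = n/2` (`0 ≤ n < 2`).
[cite: Ruelle1969, §3.4] [cite: LiebPRL1989, eq. (2)] -/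
theorem IsTorusLimitOfMixture.re_expect_nAt_down_eq_half_of_succCompanion {n : ℝ}
    (hn0 : 0 ≤ n) (hn2 : n < 2) {Ls : ℕ → ℕ} (hLs : Tendsto Ls atTop atTop) {ω' : InfVolFermionState 2}
    (hω' : ω'.IsTorusLimitOfMixture
      (fun L => Fintype.card (Subtype (spinConfig (Λ := FermionTorus 2 L) (halfRectN n L + 1) (halfRectN n L))))
      (fun L i => canonicalWeight β (sectorEigenvalue (spinConfig (halfRectN n L + 1) (halfRectN n L))
        (hubbardTorusTT' L t t' U) (hubbardTorusTT'_isHermitian L t t' U)) ((Fintype.equivFin _).symm i))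
      (fun L i => sectorEigenvector (spinConfig (halfRectN n L + 1) (halfRectN n L)) (hubbardTorusTT' L t t' U)
        (hubbardTorusTT'_isHermitian L t t' U) ((Fintype.equivFin _).symm i)) Ls) :
    (ω'.expect {0} (nAt 0 (Finset.mem_singleton_self 0) 1)).re = n / 2 :=
  (hω'.re_expect_nAt_eq_of_spinSectorGibbs t t' U β (fun L => halfRectN n L + 1) (fun L => halfRectN n L)
    (fun _ => (Fintype.equivFin _).symm) (fun _ _ => rfl) (fun _ _ => rfl) hLs
    ((eventually_halfRectN_succ_le_mul_self hn0 hn2 hLs).mono fun j hj =>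
      ⟨hj, halfRectN_le_mul_self hn0 hn2.le (Ls j)⟩)).2
    (tendsto_halfRectN_div_sq_comp hn0 hLs)

end InfVolFermionState

/-- **Eventually `log #(k_L + 1, k_L) ≤ s·L²` along `Ls → ∞` for every `s > 2H_b(n/2)`** (`0 ≤ n < 2`).
[cite: Israel1979, Lemma II.3.1] -/
theorem eventually_log_card_spinConfig_succCompanion_le {n : ℝ} (hn0 : 0 ≤ n) (hn2 : n < 2) {Ls : ℕ → ℕ}
    (hLs : Tendsto Ls atTop atTop) {s : ℝ} (hs : 2 * Real.binEntropy (n / 2) < s) :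
    ∀ᶠ j in atTop, Real.log (Fintype.card (Subtype (spinConfig (Λ := FermionTorus 2 (Ls j))
      (halfRectN n (Ls j) + 1) (halfRectN n (Ls j))))) ≤ s * (Ls j : ℝ) ^ 2 := by
  have hcont : Tendsto (fun j => Real.binEntropy (((halfRectN n (Ls j) + 1 : ℕ) : ℝ) / (Ls j : ℝ) ^ 2) +
      Real.binEntropy ((halfRectN n (Ls j) : ℝ) / (Ls j : ℝ) ^ 2)) atTop
      (𝓝 (Real.binEntropy (n / 2) + Real.binEntropy (n / 2))) :=
    ((Real.binEntropy_continuous.tendsto _).comp (tendsto_halfRectN_succ_div_sq_comp hn0 hLs)).add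
      ((Real.binEntropy_continuous.tendsto _).comp (tendsto_halfRectN_div_sq_comp hn0 hLs))
  rw [← two_mul] at hcont
  filter_upwards [hcont.eventually (gt_mem_nhds hs), eventually_halfRectN_succ_le_mul_self hn0 hn2 hLs] with j hj hk
  have hL2 : (0 : ℝ) ≤ (Ls j : ℝ) ^ 2 := sq_nonneg _
  calc Real.log (Fintype.card (Subtype (spinConfig (Λ := FermionTorus 2 (Ls j))
        (halfRectN n (Ls j) + 1) (halfRectN n (Ls j)))))
      ≤ (Ls j : ℝ) ^ 2 * (Real.binEntropy (((halfRectN n (Ls j) + 1 : ℕ) : ℝ) / (Ls j : ℝ) ^ 2) +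
          Real.binEntropy ((halfRectN n (Ls j) : ℝ) / (Ls j : ℝ) ^ 2)) :=
        log_card_subtype_spinConfig_le_binEntropy (Ls j) hk (halfRectN_le_mul_self hn0 hn2.le (Ls j))
    _ ≤ (Ls j : ℝ) ^ 2 * s := mul_le_mul_of_nonneg_left hj.le hL2
    _ = s * (Ls j : ℝ) ^ 2 := mul_comm _ _

/-- The ratio `Z_{(k+1,k)}(L)/Z_{(k,k)}(L)` is positive as soon as `k_L + 1 ≤ L²` (`0 ≤ n ≤ 2`).
[cite: Israel1979, Lemma II.3.1] -/
theorem partitionFn_ratio_succCompanion_pos {n : ℝ} (hn0 : 0 ≤ n) (hn2 : n ≤ 2) (L : ℕ)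
    (hk : halfRectN n L + 1 ≤ L * L) :
    0 < (∑ d, Real.exp (-(β * sectorEigenvalue (spinConfig (halfRectN n L + 1) (halfRectN n L))
        (hubbardTorusTT' L t t' U) (hubbardTorusTT'_isHermitian L t t' U) d))) /
      (∑ c, Real.exp (-(β * sectorEigenvalue (szConfig n L) (hubbardTorusTT' L t t' U)
        (hubbardTorusTT'_isHermitian L t t' U) c))) := by
  obtain ⟨s₁, hs₁⟩ := exists_spinConfig_of_le L hk (halfRectN_le_mul_self hn0 hn2 L)
  haveI : Nonempty (Subtype (spinConfig (Λ := FermionTorus 2 L) (halfRectN n L + 1) (halfRectN n L))) := ⟨⟨s₁, hs₁⟩⟩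
  obtain ⟨s₀, hs₀⟩ := exists_szConfig hn0 hn2 L
  haveI : Nonempty (Subtype (szConfig n L)) := ⟨⟨s₀, hs₀⟩⟩
  exact div_pos (Finset.sum_pos (fun _ _ => Real.exp_pos _) Finset.univ_nonempty)
    (Finset.sum_pos (fun _ _ => Real.exp_pos _) Finset.univ_nonempty)

/-- **The REVERSED «add↑» row: the lowering generator `c_{x↑}` read from the companion `(k + 1, k)` back to
`(k, k)`, with the INVERTED ratio `r' = lim Z_{(k,k)}/Z_{(k+1,k)}`:**
`0 ≤ β·Re ω'_{Λ₁}(c̃†(H_{Λ₁}c̃ − c̃H_{Λ₁})) − s·Re ω'_{Λ₁}(c̃†c̃) + q·r'·Re ω_{Λ₁}(c̃c̃†)` (`e^{s−1} ≤ q`).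
[cite: FawziFawziScalet2024, Thm. 3.1] [cite: BratteliRobinsonII1997, §5.4.2] [cite: LiebPRL1989, proof of Theorem 1] -/
theorem InfVolFermionState.IsTorusLimitOfMixture.re_expect_twoSector_eeb_annihilation_up_reverse_nonneg_of_succCompanion
    {n : ℝ} {Ls : ℕ → ℕ} (hLs : Tendsto Ls atTop atTop) {ω ω' : InfVolFermionState 2}
    (hω : ω.IsTorusLimitOfMixture (sectorGibbsCount n) (fun L => sectorGibbsWeightTT' β t t' U n L)
      (fun L => sectorGibbsVectorTT' t t' U n L) Ls)
    (hω' : ω'.IsTorusLimitOfMixture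
      (fun L => Fintype.card (Subtype (spinConfig (Λ := FermionTorus 2 L) (halfRectN n L + 1) (halfRectN n L))))
      (fun L i => canonicalWeight β (sectorEigenvalue (spinConfig (halfRectN n L + 1) (halfRectN n L))
        (hubbardTorusTT' L t t' U) (hubbardTorusTT'_isHermitian L t t' U)) ((Fintype.equivFin _).symm i))
      (fun L i => sectorEigenvector (spinConfig (halfRectN n L + 1) (halfRectN n L)) (hubbardTorusTT' L t t' U)
        (hubbardTorusTT'_isHermitian L t t' U) ((Fintype.equivFin _).symm i)) Ls)
    {r' : ℝ} (hr' : Tendsto (fun j =>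
      (∑ c, Real.exp (-(β * sectorEigenvalue (szConfig n (Ls j)) (hubbardTorusTT' (Ls j) t t' U)
          (hubbardTorusTT'_isHermitian (Ls j) t t' U) c))) /
        ∑ d, Real.exp (-(β * sectorEigenvalue (spinConfig (halfRectN n (Ls j) + 1) (halfRectN n (Ls j)))
          (hubbardTorusTT' (Ls j) t t' U) (hubbardTorusTT'_isHermitian (Ls j) t t' U) d))) atTop (𝓝 r'))
    {Λ : Finset (Site 2)} {x : Site 2} (hx : x ∈ Λ) {s q : ℝ} (hq : Real.exp (s - 1) ≤ q) :
    0 ≤ β * (ω'.expect (thicken Λ 1)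
          ((fermionEmbed (PolySite.incl (subset_thicken Λ 1)) (annihilation (orb (PolySite.pt x hx) 0)))ᴴ *
            ((hubbardTTPrimeFermionInteraction t t' U).localHamiltonian (thicken Λ 1) *
                fermionEmbed (PolySite.incl (subset_thicken Λ 1)) (annihilation (orb (PolySite.pt x hx) 0)) -
              fermionEmbed (PolySite.incl (subset_thicken Λ 1)) (annihilation (orb (PolySite.pt x hx) 0)) *
                (hubbardTTPrimeFermionInteraction t t' U).localHamiltonian (thicken Λ 1)))).re -
        s * (ω'.expect (thicken Λ 1)
          ((fermionEmbed (PolySite.incl (subset_thicken Λ 1)) (annihilation (orb (PolySite.pt x hx) 0)))ᴴ *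
            fermionEmbed (PolySite.incl (subset_thicken Λ 1)) (annihilation (orb (PolySite.pt x hx) 0)))).re +
        q * r' * (ω.expect (thicken Λ 1)
          (fermionEmbed (PolySite.incl (subset_thicken Λ 1)) (annihilation (orb (PolySite.pt x hx) 0)) *
            (fermionEmbed (PolySite.incl (subset_thicken Λ 1)) (annihilation (orb (PolySite.pt x hx) 0)))ᴴ)).re := by
  refine InfVolFermionState.re_expect_twoSector_eeb_nonneg_of_canonical_limits_eventually t t' U β
    (fun L => spinConfig (Λ := FermionTorus 2 L) (halfRectN n L + 1) (halfRectN n L)) (fun L => szConfig n L)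
    (fun L s s' hs hs' => hubbardTorusTT'_apply_eq_zero_of_spinConfig L t t' U _ _ s s' hs hs')
    (fun L s s' hs hs' => hubbardTorusTT'_apply_eq_zero_of_szConfig L t t' U n s s' hs hs')
    (fun L _ v s s' hs hs' => fockTranslate_apply_eq_zero_of_spinConfig L v _ _ s s' hs hs')
    (fun L _ v s s' hs hs' => fockTranslate_apply_eq_zero_of_szConfig L v n s s' hs hs')
    (fun L => (Fintype.equivFin _).symm) (fun L => sectorGibbsIndex n L)
    (fun L i => rfl) (fun L i => rfl) (sectorGibbsWeightTT'_eq_canonicalWeight t t' U β n) (fun L i => rfl)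
    hLs hω' hω hr' (annihilation (orb (PolySite.pt x hx) 0)) ?_ ?_ hq
  · filter_upwards with j hL h₁ s s' hs hs'
    rw [fermionEmbed_toTorusEmb_incl_annihilation, ← creation_conjTranspose]
    exact apply_eq_zero_off_of_mulVec_mem₂ (spinConfig _ _) (szConfig n (Ls j))
      (szSector _ _) (szSector (rectN n (Ls j)) 0) (mem_szSector_iff_spinConfig (Ls j) _ _)
      (mem_szSector_rectN_iff n (Ls j))
      (fun w hw => annihilation_up_mulVec_mem_szSector_rectN_of_succ (Ls j) _ w hw) s s' hs hs'
  · filter_upwards with j hL h₁ s s' hs hs'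
    rw [fermionEmbed_toTorusEmb_incl_annihilation, annihilation_conjTranspose]
    exact apply_eq_zero_off_of_mulVec_mem₂ (szConfig n (Ls j)) (spinConfig _ _)
      (szSector (rectN n (Ls j)) 0) (szSector _ _) (mem_szSector_rectN_iff n (Ls j))
      (mem_szSector_iff_spinConfig (Ls j) _ _)
      (fun w hw => creation_up_mulVec_mem_szSector_succ (Ls j) _ w hw) s s' hs hs'

end Basic

/-! ### §2 For a GIVEN pair `(ω, ω')` the ratio `Z_{(k+1,k)}/Z_{(k,k)}` converges to a positive number along a
subsequence -/

section Ratio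

variable (t t' U β : ℝ)

/-- `0 ≤ r/(1+r) ≤ 1` for `0 ≤ r`. [folklore] -/
private theorem div_one_add_mem_Icc₃ {r : ℝ} (hr : 0 ≤ r) : r / (1 + r) ∈ Set.Icc (0 : ℝ) 1 :=
  ⟨div_nonneg hr (by positivity), (div_le_one (by positivity)).2 (by linarith)⟩

/-- If `r_j/(1+r_j) → u < 1` then `r_j → u/(1−u)` (`r_j ≥ 0`). [folklore] -/
private theorem tendsto_of_tendsto_div_one_add₃ {r : ℕ → ℝ} (hr : ∀ j, 0 ≤ r j) {u : ℝ} (hu1 : u < 1)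
    (hu : Tendsto (fun j => r j / (1 + r j)) atTop (𝓝 u)) :
    Tendsto r atTop (𝓝 (u / (1 - u))) := by
  have h : Tendsto (fun j => r j / (1 + r j) / (1 - r j / (1 + r j))) atTop (𝓝 (u / (1 - u))) :=
    hu.div (tendsto_const_nhds.sub hu) (by linarith)
  refine h.congr fun j => ?_
  have h1 : (1 + r j) ≠ 0 := by linarith [hr j]
  have h2 : 1 - r j / (1 + r j) = 1 / (1 + r j) := by field_simp; ring
  rw [h2]
  field_simp

/-- If `r_j/(1+r_j) → 1` then `r_j⁻¹ → 0` (`r_j > 0`). [folklore] -/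
private theorem tendsto_inv_of_tendsto_div_one_add₃ {r : ℕ → ℝ} (hr : ∀ j, 0 < r j)
    (hu : Tendsto (fun j => r j / (1 + r j)) atTop (𝓝 1)) :
    Tendsto (fun j => (r j)⁻¹) atTop (𝓝 0) := by
  have h : Tendsto (fun j => (1 - r j / (1 + r j)) / (r j / (1 + r j))) atTop (𝓝 ((1 - 1) / 1)) :=
    (tendsto_const_nhds.sub hu).div hu one_ne_zero
  rw [sub_self, zero_div] at h
  refine h.congr fun j => ?_
  have h1 : (1 + r j) ≠ 0 := by linarith [hr j]
  have h2 : 1 - r j / (1 + r j) = 1 / (1 + r j) := by field_simp; ring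
  rw [h2]
  field_simp

/-- **For a GIVEN pair `(ω, ω')` the «add↑» ratio converges to a positive number along a subsequence.** Let `ω`
be the thermal object of record along `Ls → ∞` (`0 < n < 2`) and `ω'` ANY torus limit along the same `Ls` of the
canonical eigen-mixtures of the sectors `(k_L + 1, k_L)`. Then `Z_{(k+1,k)}(Ls (φ j))/Z_{(k,k)}(Ls (φ j)) → r` for
some strictly increasing `φ` and `r > 0` (Bolzano–Weierstrass for `u = r/(1+r)`; the «add↑» rows — `x`-moment
`1 − n/2` — and the reversed rows — `x`-moment `Re ω'(n_{0↑}) = n/2` — with vanishing fugacity term exclude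
`u ∈ {0, 1}`). [cite: BratteliRobinsonII1997, §5.4.2] [cite: FawziFawziScalet2024, Thm. 3.1] -/
theorem InfVolFermionState.IsTorusLimitOfMixture.exists_tendsto_partitionFn_ratio_pos_of_succCompanion
    {n : ℝ} (hn0 : 0 < n) (hn2 : n < 2) {Ls : ℕ → ℕ} (hLs : Tendsto Ls atTop atTop)
    {ω ω' : InfVolFermionState 2}
    (hω : ω.IsTorusLimitOfMixture (sectorGibbsCount n) (fun L => sectorGibbsWeightTT' β t t' U n L)
      (fun L => sectorGibbsVectorTT' t t' U n L) Ls)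
    (hω' : ω'.IsTorusLimitOfMixture
      (fun L => Fintype.card (Subtype (spinConfig (Λ := FermionTorus 2 L) (halfRectN n L + 1) (halfRectN n L))))
      (fun L i => canonicalWeight β (sectorEigenvalue (spinConfig (halfRectN n L + 1) (halfRectN n L))
        (hubbardTorusTT' L t t' U) (hubbardTorusTT'_isHermitian L t t' U)) ((Fintype.equivFin _).symm i))
      (fun L i => sectorEigenvector (spinConfig (halfRectN n L + 1) (halfRectN n L)) (hubbardTorusTT' L t t' U)
        (hubbardTorusTT'_isHermitian L t t' U) ((Fintype.equivFin _).symm i)) Ls) :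
    ∃ φ : ℕ → ℕ, StrictMono φ ∧ ∃ r : ℝ, 0 < r ∧ Tendsto (fun j =>
        (∑ d, Real.exp (-(β * sectorEigenvalue (spinConfig (halfRectN n (Ls (φ j)) + 1) (halfRectN n (Ls (φ j))))
            (hubbardTorusTT' (Ls (φ j)) t t' U) (hubbardTorusTT'_isHermitian (Ls (φ j)) t t' U) d))) /
          (∑ c, Real.exp (-(β * sectorEigenvalue (szConfig n (Ls (φ j))) (hubbardTorusTT' (Ls (φ j)) t t' U)
            (hubbardTorusTT'_isHermitian (Ls (φ j)) t t' U) c)))) atTop (𝓝 r) := by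
  have hn0' : 0 ≤ n := hn0.le
  have hn2' : n ≤ 2 := hn2.le
  set R : ℕ → ℝ := fun L =>
    (∑ d, Real.exp (-(β * sectorEigenvalue (spinConfig (halfRectN n L + 1) (halfRectN n L))
        (hubbardTorusTT' L t t' U) (hubbardTorusTT'_isHermitian L t t' U) d))) /
      (∑ c, Real.exp (-(β * sectorEigenvalue (szConfig n L) (hubbardTorusTT' L t t' U)
        (hubbardTorusTT'_isHermitian L t t' U) c))) with hR
  -- a tail on which the image sector is nonempty
  obtain ⟨j₀, hj₀⟩ := eventually_atTop.1 (eventually_halfRectN_succ_le_mul_self hn0' hn2 hLs)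
  set φ₀ : ℕ → ℕ := fun j => j + j₀ with hφ₀
  have hφ₀m : StrictMono φ₀ := fun i j hij => Nat.add_lt_add_right hij j₀
  have hLs₀ : Tendsto (Ls ∘ φ₀) atTop atTop := hLs.comp hφ₀m.tendsto_atTop
  have hRpos : ∀ j, 0 < R (Ls (φ₀ j)) := fun j =>
    partitionFn_ratio_succCompanion_pos t t' U β hn0' hn2' (Ls (φ₀ j)) (hj₀ (j + j₀) (Nat.le_add_left _ _))
  -- Bolzano–Weierstrass for `u = R/(1+R)` along the tail
  have humem : ∀ j, R (Ls (φ₀ j)) / (1 + R (Ls (φ₀ j))) ∈ Set.Icc (0 : ℝ) 1 := fun j =>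
    div_one_add_mem_Icc₃ (hRpos j).le
  obtain ⟨u, hu, φ₁, hφ₁, hlim⟩ := tendsto_subseq_of_bounded (Metric.isBounded_Icc 0 1) humem
  rw [isClosed_Icc.closure_eq] at hu
  set φ : ℕ → ℕ := fun j => φ₀ (φ₁ j) with hφdef
  have hφ : StrictMono φ := hφ₀m.comp hφ₁
  have hLsφ : Tendsto (Ls ∘ φ) atTop atTop := hLs.comp hφ.tendsto_atTop
  have hωφ := hω.comp_tendsto hφ.tendsto_atTop
  have hω'φ := hω'.comp_tendsto hφ.tendsto_atTop
  have hRposφ : ∀ j, 0 < R (Ls (φ j)) := fun j => hRpos (φ₁ j)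
  have hlim' : Tendsto (fun j => R (Ls (φ j)) / (1 + R (Ls (φ j)))) atTop (𝓝 u) := hlim
  -- the two one-site densities
  have hxeq : (ω.expect (thicken ({0} : Finset (Site 2)) 1)
      (fermionEmbed (PolySite.incl (subset_thicken {0} 1))
          (annihilation (orb (PolySite.pt (0 : Site 2) (Finset.mem_singleton_self 0)) 0)) *
        (fermionEmbed (PolySite.incl (subset_thicken {0} 1))
          (annihilation (orb (PolySite.pt (0 : Site 2) (Finset.mem_singleton_self 0)) 0)))ᴴ)).re = 1 - n / 2 := by
    rw [hω.isTranslationInvariant.expect_fermionEmbed_incl_cAt_mul_conjTranspose, Complex.sub_re, Complex.one_re,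
      hω.re_expect_nAt_eq_half_of_sectorGibbs t t' U β hn0' hn2' hLs 0]
  have hyeq : (ω'.expect (thicken ({0} : Finset (Site 2)) 1)
      ((fermionEmbed (PolySite.incl (subset_thicken {0} 1))
          (annihilation (orb (PolySite.pt (0 : Site 2) (Finset.mem_singleton_self 0)) 0)))ᴴ *
        fermionEmbed (PolySite.incl (subset_thicken {0} 1))
          (annihilation (orb (PolySite.pt (0 : Site 2) (Finset.mem_singleton_self 0)) 0)))).re = n / 2 := by
    rw [hω'φ.isTranslationInvariant.expect_conjTranspose_mul_fermionEmbed_incl_cAt,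
      hω'φ.re_expect_nAt_up_eq_half_of_succCompanion t t' U β hn0' hn2 hLsφ]
  -- `u ≠ 0`: the «add↑» rows with a vanishing fugacity term
  have hu0 : u ≠ 0 := by
    rintro rfl
    have hr0 : Tendsto (fun j => R (Ls (φ j))) atTop (𝓝 0) := by
      have h := tendsto_of_tendsto_div_one_add₃ (fun j => (hRposφ j).le) zero_lt_one hlim'
      rwa [zero_div] at h
    have hx0 : 0 < 1 - n / 2 := by linarith
    exact not_forall_linear_rows_zero hx0 fun s q hq => by
      have h := hωφ.re_expect_twoSector_eeb_creation_up_nonneg_of_sectorGibbs t t' U β hLsφ hω'φ hr0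
        (Λ := {0}) (x := 0) (Finset.mem_singleton_self 0) hq
      rw [← annihilation_conjTranspose, fermionEmbed_conjTranspose, conjTranspose_conjTranspose, hxeq] at h
      exact h
  -- `u ≠ 1`: the reversed rows (inverse ratio `→ 0`)
  have hu1 : u ≠ 1 := by
    rintro rfl
    have hr0 : Tendsto (fun j =>
        (∑ c, Real.exp (-(β * sectorEigenvalue (szConfig n (Ls (φ j))) (hubbardTorusTT' (Ls (φ j)) t t' U)
            (hubbardTorusTT'_isHermitian (Ls (φ j)) t t' U) c))) /
          ∑ d, Real.exp (-(β * sectorEigenvalue (spinConfig (halfRectN n (Ls (φ j)) + 1) (halfRectN n (Ls (φ j))))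
            (hubbardTorusTT' (Ls (φ j)) t t' U) (hubbardTorusTT'_isHermitian (Ls (φ j)) t t' U) d))) atTop (𝓝 0) := by
      have h := tendsto_inv_of_tendsto_div_one_add₃ hRposφ hlim'
      refine h.congr fun j => ?_
      rw [hR, inv_div]
    exact not_forall_linear_rows_zero (half_pos hn0) fun s q hq => by
      have h := hωφ.re_expect_twoSector_eeb_annihilation_up_reverse_nonneg_of_succCompanion t t' U β hLsφ hω'φ hr0
        (Λ := {0}) (x := 0) (Finset.mem_singleton_self 0) hq
      rw [hyeq] at h
      exact h
  have hu0' : 0 < u := lt_of_le_of_ne hu.1 (Ne.symm hu0)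
  have hu1' : u < 1 := lt_of_le_of_ne hu.2 hu1
  exact ⟨φ, hφ, u / (1 - u), div_pos hu0' (by linarith),
    tendsto_of_tendsto_div_one_add₃ (fun j => (hRposφ j).le) hu1' hlim'⟩

end Ratio

/-! ### §3 Energy-window rows of the «add↑» companion -/

section Windows

variable (t t' U β : ℝ)

/-- **`e_Φ(ω') ≤ e_Φ(ω) + 2·H_b(n/2)/β`** for the «add↑» companion (`β > 0`, `0 < n < 2`; no sign of `U`).
[cite: Israel1979, Lemma II.3.1] [cite: BratteliRobinsonII1997, §5.4.2] [cite: Ruelle1969, §3.4] -/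
theorem InfVolFermionState.IsTorusLimitOfMixture.meanEnergy_succCompanion_le_meanEnergy_add
    (hβ : 0 < β) {n : ℝ} (hn0 : 0 < n) (hn2 : n < 2) {Ls : ℕ → ℕ} (hLs : Tendsto Ls atTop atTop)
    {ω ω' : InfVolFermionState 2}
    (hω : ω.IsTorusLimitOfMixture (sectorGibbsCount n) (fun L => sectorGibbsWeightTT' β t t' U n L)
      (fun L => sectorGibbsVectorTT' t t' U n L) Ls)
    (hω' : ω'.IsTorusLimitOfMixture
      (fun L => Fintype.card (Subtype (spinConfig (Λ := FermionTorus 2 L) (halfRectN n L + 1) (halfRectN n L))))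
      (fun L i => canonicalWeight β (sectorEigenvalue (spinConfig (halfRectN n L + 1) (halfRectN n L))
        (hubbardTorusTT' L t t' U) (hubbardTorusTT'_isHermitian L t t' U)) ((Fintype.equivFin _).symm i))
      (fun L i => sectorEigenvector (spinConfig (halfRectN n L + 1) (halfRectN n L)) (hubbardTorusTT' L t t' U)
        (hubbardTorusTT'_isHermitian L t t' U) ((Fintype.equivFin _).symm i)) Ls) :
    ω'.meanEnergy (hubbardTTPrimeFermionInteraction t t' U) 1 ≤
      ω.meanEnergy (hubbardTTPrimeFermionInteraction t t' U) 1 + 2 * Real.binEntropy (n / 2) / β := by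
  have hn0' : 0 ≤ n := hn0.le
  have hn2' : n ≤ 2 := hn2.le
  obtain ⟨φ, hφ, r, hr0, hr⟩ := hω.exists_tendsto_partitionFn_ratio_pos_of_succCompanion t t' U β hn0 hn2 hLs hω'
  have hLsφ : Tendsto (Ls ∘ φ) atTop atTop := hLs.comp hφ.tendsto_atTop
  refine le_of_forall_pos_le_add fun ε hε => ?_
  have hs : 2 * Real.binEntropy (n / 2) < 2 * Real.binEntropy (n / 2) + β * ε := by
    linarith [mul_pos hβ hε]
  have hev := eventually_log_card_spinConfig_succCompanion_le hn0' hn2 hLsφ hs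
  have hcap := InfVolFermionState.IsTorusLimitOfMixture.meanEnergy_le_meanEnergy_add_of_partitionRatio t t' U β hβ
    (fun L => szConfig n L) (fun L => spinConfig (Λ := FermionTorus 2 L) (halfRectN n L + 1) (halfRectN n L))
    (fun L s s' hs hs' => hubbardTorusTT'_apply_eq_zero_of_szConfig L t t' U n s s' hs hs')
    (fun L s s' hs hs' => hubbardTorusTT'_apply_eq_zero_of_spinConfig L t t' U _ _ s s' hs hs')
    (fun L => sectorGibbsIndex n L) (fun L => (Fintype.equivFin _).symm)
    (sectorGibbsWeightTT'_eq_canonicalWeight t t' U β n) (fun L i => rfl) (fun L i => rfl) (fun L i => rfl)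
    hLsφ (hω.comp_tendsto hφ.tendsto_atTop) (hω'.comp_tendsto hφ.tendsto_atTop)
    (Eventually.of_forall fun j => by
      obtain ⟨s₀, hs₀⟩ := exists_szConfig hn0' hn2' (Ls (φ j))
      exact ⟨⟨s₀, hs₀⟩⟩)
    ((eventually_halfRectN_succ_le_mul_self hn0' hn2 hLsφ).mono fun j hj => by
      obtain ⟨s₁, hs₁⟩ := exists_spinConfig_of_le (Ls (φ j)) hj (halfRectN_le_mul_self hn0' hn2' _)
      exact ⟨⟨s₁, hs₁⟩⟩)
    hr0 hr hev
  have hsplit : (2 * Real.binEntropy (n / 2) + β * ε) / β = 2 * Real.binEntropy (n / 2) / β + ε := by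
    rw [add_div, mul_div_assoc, mul_div_cancel_left₀ ε hβ.ne']
  linarith [hcap, hsplit]

/-- **`e_Φ(ω) ≤ e_Φ(ω') + 2·H_b(n/2)/β`** for the «add↑» companion. [cite: Israel1979, Lemma II.3.1]
[cite: BratteliRobinsonII1997, §5.4.2] [cite: Ruelle1969, §3.4] -/
theorem InfVolFermionState.IsTorusLimitOfMixture.meanEnergy_le_meanEnergy_succCompanion_add
    (hβ : 0 < β) {n : ℝ} (hn0 : 0 < n) (hn2 : n < 2) {Ls : ℕ → ℕ} (hLs : Tendsto Ls atTop atTop)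
    {ω ω' : InfVolFermionState 2}
    (hω : ω.IsTorusLimitOfMixture (sectorGibbsCount n) (fun L => sectorGibbsWeightTT' β t t' U n L)
      (fun L => sectorGibbsVectorTT' t t' U n L) Ls)
    (hω' : ω'.IsTorusLimitOfMixture
      (fun L => Fintype.card (Subtype (spinConfig (Λ := FermionTorus 2 L) (halfRectN n L + 1) (halfRectN n L))))
      (fun L i => canonicalWeight β (sectorEigenvalue (spinConfig (halfRectN n L + 1) (halfRectN n L))
        (hubbardTorusTT' L t t' U) (hubbardTorusTT'_isHermitian L t t' U)) ((Fintype.equivFin _).symm i))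
      (fun L i => sectorEigenvector (spinConfig (halfRectN n L + 1) (halfRectN n L)) (hubbardTorusTT' L t t' U)
        (hubbardTorusTT'_isHermitian L t t' U) ((Fintype.equivFin _).symm i)) Ls) :
    ω.meanEnergy (hubbardTTPrimeFermionInteraction t t' U) 1 ≤
      ω'.meanEnergy (hubbardTTPrimeFermionInteraction t t' U) 1 + 2 * Real.binEntropy (n / 2) / β := by
  have hn0' : 0 ≤ n := hn0.le
  have hn2' : n ≤ 2 := hn2.le
  obtain ⟨φ, hφ, r, hr0, hr⟩ := hω.exists_tendsto_partitionFn_ratio_pos_of_succCompanion t t' U β hn0 hn2 hLs hω'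
  have hLsφ : Tendsto (Ls ∘ φ) atTop atTop := hLs.comp hφ.tendsto_atTop
  have hr' : Tendsto (fun j =>
      (∑ c, Real.exp (-(β * sectorEigenvalue (szConfig n (Ls (φ j))) (hubbardTorusTT' (Ls (φ j)) t t' U)
          (hubbardTorusTT'_isHermitian (Ls (φ j)) t t' U) c))) /
        ∑ d, Real.exp (-(β * sectorEigenvalue (spinConfig (halfRectN n (Ls (φ j)) + 1) (halfRectN n (Ls (φ j))))
          (hubbardTorusTT' (Ls (φ j)) t t' U) (hubbardTorusTT'_isHermitian (Ls (φ j)) t t' U) d))) atTop (𝓝 r⁻¹) := by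
    refine (hr.inv₀ hr0.ne').congr fun j => ?_
    rw [inv_div]
  refine le_of_forall_pos_le_add fun ε hε => ?_
  have hs : 2 * Real.binEntropy (n / 2) < 2 * Real.binEntropy (n / 2) + β * ε := by
    linarith [mul_pos hβ hε]
  have hev : ∀ᶠ j in atTop, Real.log (Fintype.card (Subtype (szConfig n ((Ls ∘ φ) j)))) ≤
      (2 * Real.binEntropy (n / 2) + β * ε) * (((Ls ∘ φ) j : ℕ) : ℝ) ^ 2 :=
    (hLsφ.eventually (eventually_log_sectorGibbsCount_le hn0' hn2' hs)).mono fun j hj => hj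
  have hcap := InfVolFermionState.IsTorusLimitOfMixture.meanEnergy_le_meanEnergy_add_of_partitionRatio t t' U β hβ
    (fun L => spinConfig (Λ := FermionTorus 2 L) (halfRectN n L + 1) (halfRectN n L)) (fun L => szConfig n L)
    (fun L s s' hs hs' => hubbardTorusTT'_apply_eq_zero_of_spinConfig L t t' U _ _ s s' hs hs')
    (fun L s s' hs hs' => hubbardTorusTT'_apply_eq_zero_of_szConfig L t t' U n s s' hs hs')
    (fun L => (Fintype.equivFin _).symm) (fun L => sectorGibbsIndex n L)
    (fun L i => rfl) (fun L i => rfl) (sectorGibbsWeightTT'_eq_canonicalWeight t t' U β n) (fun L i => rfl)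
    hLsφ (hω'.comp_tendsto hφ.tendsto_atTop) (hω.comp_tendsto hφ.tendsto_atTop)
    ((eventually_halfRectN_succ_le_mul_self hn0' hn2 hLsφ).mono fun j hj => by
      obtain ⟨s₁, hs₁⟩ := exists_spinConfig_of_le (Ls (φ j)) hj (halfRectN_le_mul_self hn0' hn2' _)
      exact ⟨⟨s₁, hs₁⟩⟩)
    (Eventually.of_forall fun j => by
      obtain ⟨s₀, hs₀⟩ := exists_szConfig hn0' hn2' (Ls (φ j))
      exact ⟨⟨s₀, hs₀⟩⟩)
    (inv_pos.2 hr0) hr' hev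
  have hsplit : (2 * Real.binEntropy (n / 2) + β * ε) / β = 2 * Real.binEntropy (n / 2) / β + ε := by
    rw [add_div, mul_div_assoc, mul_div_cancel_left₀ ε hβ.ne']
  linarith [hcap, hsplit]

/-- **Energy FLOOR for the «add↑» companion**: `e(t,t',U,n) ≤ e_Φ(ω')` (`U ≥ 0`, `0 < n < 2`).
[cite: Ruelle1969, §3.4] -/
theorem InfVolFermionState.IsTorusLimitOfMixture.energyDensityTT'_le_meanEnergy_succCompanion
    (hU : 0 ≤ U) {n : ℝ} (hn0 : 0 < n) (hn2 : n < 2) {Ls : ℕ → ℕ} (hLs : Tendsto Ls atTop atTop)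
    {ω' : InfVolFermionState 2}
    (hω' : ω'.IsTorusLimitOfMixture
      (fun L => Fintype.card (Subtype (spinConfig (Λ := FermionTorus 2 L) (halfRectN n L + 1) (halfRectN n L))))
      (fun L i => canonicalWeight β (sectorEigenvalue (spinConfig (halfRectN n L + 1) (halfRectN n L))
        (hubbardTorusTT' L t t' U) (hubbardTorusTT'_isHermitian L t t' U)) ((Fintype.equivFin _).symm i))
      (fun L i => sectorEigenvector (spinConfig (halfRectN n L + 1) (halfRectN n L)) (hubbardTorusTT' L t t' U)
        (hubbardTorusTT'_isHermitian L t t' U) ((Fintype.equivFin _).symm i)) Ls) :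
    energyDensityTT' t t' U n ≤ ω'.meanEnergy (hubbardTTPrimeFermionInteraction t t' U) 1 := by
  have hρ : ω'.density = n := by
    rw [InfVolFermionState.density, InfVolFermionState.densityAt, map_add, Complex.add_re,
      hω'.re_expect_nAt_up_eq_half_of_succCompanion t t' U β hn0.le hn2 hLs,
      hω'.re_expect_nAt_down_eq_half_of_succCompanion t t' U β hn0.le hn2 hLs]
    ring
  exact InfVolFermionState.energyDensityTT'_le_meanEnergy_of_isTranslationInvariant t t' hU hn0 hn2
    hω'.isTranslationInvariant hρ

/-- **Energy CAP for the «add↑» companion = the record N2′ cap** (`β > 0`, `U ≥ 0`, `0 < n < 2`):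
`e_Φ(ω') ≤ e(t,t',U,n) + 2·H_b(n/2)/β`. [cite: Israel1979, Lemma II.3.1] [cite: Ruelle1969, §3.4] -/
theorem InfVolFermionState.IsTorusLimitOfMixture.meanEnergy_succCompanion_le_energyDensityTT'_add
    (hβ : 0 < β) (hU : 0 ≤ U) {n : ℝ} (hn0 : 0 < n) (hn2 : n < 2) {Ls : ℕ → ℕ}
    (hLs : Tendsto Ls atTop atTop) {ω ω' : InfVolFermionState 2}
    (hω : ω.IsTorusLimitOfMixture (sectorGibbsCount n) (fun L => sectorGibbsWeightTT' β t t' U n L)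
      (fun L => sectorGibbsVectorTT' t t' U n L) Ls)
    (hω' : ω'.IsTorusLimitOfMixture
      (fun L => Fintype.card (Subtype (spinConfig (Λ := FermionTorus 2 L) (halfRectN n L + 1) (halfRectN n L))))
      (fun L i => canonicalWeight β (sectorEigenvalue (spinConfig (halfRectN n L + 1) (halfRectN n L))
        (hubbardTorusTT' L t t' U) (hubbardTorusTT'_isHermitian L t t' U)) ((Fintype.equivFin _).symm i))
      (fun L i => sectorEigenvector (spinConfig (halfRectN n L + 1) (halfRectN n L)) (hubbardTorusTT' L t t' U)
        (hubbardTorusTT'_isHermitian L t t' U) ((Fintype.equivFin _).symm i)) Ls) :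
    ω'.meanEnergy (hubbardTTPrimeFermionInteraction t t' U) 1 ≤
      energyDensityTT' t t' U n + 2 * Real.binEntropy (n / 2) / β := by
  have hn0' : 0 ≤ n := hn0.le
  have hn2' : n ≤ 2 := hn2.le
  obtain ⟨φ, hφ, r, hr0, hr⟩ := hω.exists_tendsto_partitionFn_ratio_pos_of_succCompanion t t' U β hn0 hn2 hLs hω'
  have hLsφ : Tendsto (Ls ∘ φ) atTop atTop := hLs.comp hφ.tendsto_atTop
  refine le_of_forall_pos_le_add fun ε hε => ?_
  have hs : 2 * Real.binEntropy (n / 2) < 2 * Real.binEntropy (n / 2) + β * ε := by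
    linarith [mul_pos hβ hε]
  have hev := eventually_log_card_spinConfig_succCompanion_le hn0' hn2 hLsφ hs
  have hcap := InfVolFermionState.IsTorusLimitOfMixture.meanEnergy_companion_le_energyDensityTT'_add_of_partitionRatio
    t t' U β hβ hU hn0 hn2
    (fun L => spinConfig (Λ := FermionTorus 2 L) (halfRectN n L + 1) (halfRectN n L))
    (fun L s s' hs hs' => hubbardTorusTT'_apply_eq_zero_of_spinConfig L t t' U _ _ s s' hs hs')
    (fun L => (Fintype.equivFin _).symm) (fun L i => rfl) (fun L i => rfl) hLsφ
    (hω'.comp_tendsto hφ.tendsto_atTop)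
    ((eventually_halfRectN_succ_le_mul_self hn0' hn2 hLsφ).mono fun j hj => by
      obtain ⟨s₁, hs₁⟩ := exists_spinConfig_of_le (Ls (φ j)) hj (halfRectN_le_mul_self hn0' hn2' _)
      exact ⟨⟨s₁, hs₁⟩⟩)
    hr0 hr hev
  have hsplit : (2 * Real.binEntropy (n / 2) + β * ε) / β = 2 * Real.binEntropy (n / 2) / β + ε := by
    rw [add_div, mul_div_assoc, mul_div_cancel_left₀ ε hβ.ne']
  linarith [hcap, hsplit]

/-- **The «add↑» companion obeys EXACTLY the record N2′ window** (`β > 0`, `U ≥ 0`, `0 < n < 2`):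
`e(n) ≤ e_Φ(ω') ≤ e(n) + 2·H_b(n/2)/β`. [cite: Israel1979, Lemma II.3.1] [cite: Ruelle1969, §3.4] -/
theorem InfVolFermionState.IsTorusLimitOfMixture.meanEnergy_succCompanion_mem_Icc
    (hβ : 0 < β) (hU : 0 ≤ U) {n : ℝ} (hn0 : 0 < n) (hn2 : n < 2) {Ls : ℕ → ℕ}
    (hLs : Tendsto Ls atTop atTop) {ω ω' : InfVolFermionState 2}
    (hω : ω.IsTorusLimitOfMixture (sectorGibbsCount n) (fun L => sectorGibbsWeightTT' β t t' U n L)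
      (fun L => sectorGibbsVectorTT' t t' U n L) Ls)
    (hω' : ω'.IsTorusLimitOfMixture
      (fun L => Fintype.card (Subtype (spinConfig (Λ := FermionTorus 2 L) (halfRectN n L + 1) (halfRectN n L))))
      (fun L i => canonicalWeight β (sectorEigenvalue (spinConfig (halfRectN n L + 1) (halfRectN n L))
        (hubbardTorusTT' L t t' U) (hubbardTorusTT'_isHermitian L t t' U)) ((Fintype.equivFin _).symm i))
      (fun L i => sectorEigenvector (spinConfig (halfRectN n L + 1) (halfRectN n L)) (hubbardTorusTT' L t t' U)
        (hubbardTorusTT'_isHermitian L t t' U) ((Fintype.equivFin _).symm i)) Ls) :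
    ω'.meanEnergy (hubbardTTPrimeFermionInteraction t t' U) 1 ∈
      Set.Icc (energyDensityTT' t t' U n) (energyDensityTT' t t' U n + 2 * Real.binEntropy (n / 2) / β) :=
  ⟨hω'.energyDensityTT'_le_meanEnergy_succCompanion t t' U β hU hn0 hn2 hLs,
    hω.meanEnergy_succCompanion_le_energyDensityTT'_add t t' U β hβ hU hn0 hn2 hLs hω'⟩

end Windows

/-! ### §4 The thermal reader for the «add↑» companion -/

section Reader

namespace InfVolFermionState

/-- **The `D₄`-reduced thermal window certificate READER for the «add↑» companion `(k_L + 1, k_L)`, densities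
evaluated** (`0 ≤ n < 2`): every thermal window certificate (operator identity of
`re_expect_ge_of_thermal_certificate_TT'_of_rows`, `thicken Λ 1 ⊆ Λ'`, arbitrary `D₄` labels, charged words of
nonzero charge, gauge-invariant EEB generators, `λᵣ, κₑ ≥ 0`, extra rows with `0 ≤ Re ω'(Gₑ)`) proves
`c − Σₖ ‖aₖ‖ + (Σ_σ μ_σ)(n/2 − ν) + κ (u − e^{tt'}(ω')) ≤ Re ω'_{Λ'}(Xw)`. [cite: FawziFawziScalet2024, Thm. 3.6] -/
theorem IsTorusLimitOfMixture.re_expect_ge_of_thermal_certificate_d4_TT'_of_succCompanion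
    (t t' U β : ℝ) {n : ℝ} (hn0 : 0 ≤ n) (hn2 : n < 2) {Ls : ℕ → ℕ} (hLs : Tendsto Ls atTop atTop)
    {ω : InfVolFermionState 2}
    (h : ω.IsTorusLimitOfMixture
      (fun L => Fintype.card (Subtype (spinConfig (Λ := FermionTorus 2 L) (halfRectN n L + 1) (halfRectN n L))))
      (fun L i => canonicalWeight β (sectorEigenvalue (spinConfig (halfRectN n L + 1) (halfRectN n L))
        (hubbardTorusTT' L t t' U) (hubbardTorusTT'_isHermitian L t t' U)) ((Fintype.equivFin _).symm i))
      (fun L i => sectorEigenvector (spinConfig (halfRectN n L + 1) (halfRectN n L)) (hubbardTorusTT' L t t' U)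
        (hubbardTorusTT'_isHermitian L t t' U) ((Fintype.equivFin _).symm i)) Ls)
    {Λ Λ' : Finset (Site 2)} (hΛ : Λ ⊆ Λ') (h8 : thicken Λ 1 ⊆ Λ')
    (h0 : thicken ({0} : Finset (Site 2)) 1 ⊆ Λ') (hz : (0 : Site 2) ∈ Λ')
    (Xw : FermionOp Λ') (κ u : ℝ) (μ : Fin 2 → ℝ) (ν : ℝ)
    {m : Type*} [Fintype m] [DecidableEq m] {Λm : Matrix m m ℂ} (hΛm : Λm.PosSemidef)
    (O : m → FermionOp Λ')
    {κ' : Type*} (s : Finset κ') (B : κ' → FermionOp Λ)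
    {ι : Type*} (tt : Finset ι) (γ : ι → DihedralGroup 4) (wv : ι → Site 2)
    (hsh : ∀ l, d4ShiftSet (γ l) (wv l) Λ ⊆ Λ') (Y : ι → FermionOp Λ)
    {ρ : Type*} (uu : Finset ρ) (b : ρ → ℂ) (cw : ρ → List (Orb (PolySite Λ') × Bool))
    (hcw : ∀ j ∈ uu, ladderCharge (cw j) ≠ 0 ∨ ladderSpinCharge (cw j) ≠ 0)
    {θ : Type*} (rr : Finset θ) (lam : θ → ℝ) (hlam : ∀ r ∈ rr, 0 ≤ lam r) (A : θ → FermionOp Λ)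
    (hAN : ∀ r ∈ rr, Commute (A r) (totalNumber : FermionOp Λ))
    (hAS : ∀ r ∈ rr, Commute (A r) (HubbardWave0.spinZ : FermionOp Λ))
    (sv qv : θ → ℝ) (hq : ∀ r ∈ rr, Real.exp (sv r - 1) ≤ qv r)
    {η : Type*} (gg : Finset η) (kap : η → ℝ) (hkap : ∀ e ∈ gg, 0 ≤ kap e) (G : η → FermionOp Λ')
    (hG : ∀ e ∈ gg, 0 ≤ (ω.expect Λ' (G e)).re)
    {δ : Type*} (ah : Finset δ) (dc : δ → ℝ) (V : δ → FermionOp Λ')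
    {κ'' : Type*} (w : Finset κ'') (a : κ'' → ℂ) (word : κ'' → List (Orb (PolySite Λ') × Bool)) {c : ℝ}
    (hcert : Xw - (c : ℂ) • (1 : FermionOp Λ') -
        ∑ σ : Fin 2, ((μ σ : ℝ) : ℂ) • (nAt 0 hz σ - ((ν : ℝ) : ℂ) • (1 : FermionOp Λ')) -
        ((κ : ℝ) : ℂ) • (((u : ℝ) : ℂ) • (1 : FermionOp Λ') -
          fermionEmbed (PolySite.incl h0) ((hubbardTTPrimeFermionInteraction t t' U).meanEnergyObs 1)) =
      gramForm Λm O +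
        (∑ k ∈ s, ((hubbardTTPrimeFermionInteraction t t' U).localHamiltonian Λ' * fermionEmbed (PolySite.incl hΛ) (B k) -
            fermionEmbed (PolySite.incl hΛ) (B k) * (hubbardTTPrimeFermionInteraction t t' U).localHamiltonian Λ') +
          ∑ l ∈ tt, (fermionEmbed (PolySite.incl (hsh l)) (fermionEmbed (PolySite.d4Emb (γ l) (wv l) Λ) (Y l)) -
            fermionEmbed (PolySite.incl hΛ) (Y l)) +
          ∑ j ∈ uu, b j • ladderWord (cw j)) +
        (∑ r ∈ rr, ((lam r : ℝ) : ℂ) •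
            (((β : ℝ) : ℂ) • ((fermionEmbed (PolySite.incl hΛ) (A r))ᴴ *
                ((hubbardTTPrimeFermionInteraction t t' U).localHamiltonian Λ' * fermionEmbed (PolySite.incl hΛ) (A r) -
                  fermionEmbed (PolySite.incl hΛ) (A r) * (hubbardTTPrimeFermionInteraction t t' U).localHamiltonian Λ')) -
              ((sv r : ℝ) : ℂ) • ((fermionEmbed (PolySite.incl hΛ) (A r))ᴴ * fermionEmbed (PolySite.incl hΛ) (A r)) +
              ((qv r : ℝ) : ℂ) • (fermionEmbed (PolySite.incl hΛ) (A r) * (fermionEmbed (PolySite.incl hΛ) (A r))ᴴ)) +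
          ∑ e ∈ gg, ((kap e : ℝ) : ℂ) • G e) +
        (∑ m' ∈ ah, ((dc m' : ℝ) : ℂ) • ((V m')ᴴ - V m') + ∑ k ∈ w, a k • ladderWord (word k))) :
    c - ∑ k ∈ w, ‖a k‖ + (∑ σ : Fin 2, μ σ) * (n / 2 - ν) +
        κ * (u - ω.meanEnergy (hubbardTTPrimeFermionInteraction t t' U) 1) ≤
      (ω.expect Λ' Xw).re := by
  have hmain := h.re_expect_ge_of_thermal_certificate_d4_TT'_of_spinSectorGibbs t t' U β
    (fun L => halfRectN n L + 1) (fun L => halfRectN n L) (fun L => (Fintype.equivFin _).symm)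
    (fun L i => rfl) (fun L i => rfl) hLs hΛ h8 h0 hz Xw κ u μ ν hΛm O s B tt γ wv hsh Y uu b cw hcw rr lam hlam A
    hAN hAS sv qv hq gg kap hkap G hG ah dc V w a word hcert
  -- densities: both `n/2`
  have hup : (ω.expect Λ' (nAt 0 hz 0)).re = n / 2 := by
    rw [ω.expect_nAt_eq_expect_nAt_singleton hz 0]
    exact h.re_expect_nAt_up_eq_half_of_succCompanion t t' U β hn0 hn2 hLs
  have hdown : (ω.expect Λ' (nAt 0 hz 1)).re = n / 2 := by
    rw [ω.expect_nAt_eq_expect_nAt_singleton hz 1]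
    exact h.re_expect_nAt_down_eq_half_of_succCompanion t t' U β hn0 hn2 hLs
  have hdens : ∑ σ : Fin 2, μ σ * ((ω.expect Λ' (nAt 0 hz σ)).re - ν) = (∑ σ : Fin 2, μ σ) * (n / 2 - ν) := by
    rw [Fin.sum_univ_two, Fin.sum_univ_two, hup, hdown]
    ring
  rw [hdens] at hmain
  exact hmain


end InfVolFermionState

end Reader

end Literature.MathematicalPhysics.QuantumLattice

end
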